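import Summits.AnomalousDissipation.AnomalousDissipation.Theorems.MomentParityQuarticGateDesignSymShift
import Summits.AnomalousDissipation.AnomalousDissipation.Theorems.MomentParityQuarticGateEnstrophy
import Literature.Analysis.FluidPDE.CylindricalGenerator

/-!
# Shear translations as homeomorphisms of the energy space

Helper file for stub S6′ (`stub_order2DesignSym`) of the line `axis-sectors` of crux
`MomentParity.QuarticGate`. Translation `u ↦ u(· + a)` of `L²` classes (Mathlib's
`Lp.compMeasurePreservingₗᵢ` for the measure-preserving map `x ↦ x + a`) preserves the energy space
`H` (the closed span of the smooth solenoidal mean-zero fields, which translation permutes) and is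
undone by translation by `-a`; this gives a family of homeomorphisms `T a : H ≃ₜ H` represented a.e.
by `x ↦ u(x + a)` (`exists_shiftOp`). For ANY such family the observables of the crux transform
covariantly: pairings `(T a u, g) = (u, g(· - a))`, the generator rows
`⟨F(T a u), g⟩ = ⟨F(u), g(· - a)⟩` for a force invariant under `a`, the energy row and the
helicity row are invariant, and so are `‖u‖`, `‖∇u‖²` and the level property.
-/

namespace Summit.AnomalousDissipation.AnomalousDissipation.Theorems.MomentParityQuarticGate

open MeasureTheory Filter
open scoped InnerProductSpace RealInnerProductSpace ENNReal
open Literature.Analysis.FunctionSpaces Literature.Analysis.FluidPDE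
open Summit.AnomalousDissipation.AnomalousDissipation.Theorems.QuarticGate.Negative

set_option linter.dupNamespace false

noncomputable section

/-- **Shear translations act on the energy space by homeomorphisms**: there is a family
`T a : H ≃ₜ H`, `a ∈ T³`, with `T a u` represented a.e. by `x ↦ u(x + a)`. [folklore] -/
theorem exists_shiftOp :
    ∃ T : UnitAddTorus (Fin 3) → Torus.energySpace (Fin 3) ≃ₜ Torus.energySpace (Fin 3),
      ∀ (a : UnitAddTorus (Fin 3)) (u : Torus.energySpace (Fin 3)),
        (((T a u).1 : Lp (EuclideanSpace ℝ (Fin 3)) 2 (volume : Measure (UnitAddTorus (Fin 3)))) :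
            UnitAddTorus (Fin 3) → EuclideanSpace ℝ (Fin 3)) =ᵐ[volume]
          fun x => ((u.1 : Lp (EuclideanSpace ℝ (Fin 3)) 2 (volume : Measure (UnitAddTorus (Fin 3)))) :
            UnitAddTorus (Fin 3) → EuclideanSpace ℝ (Fin 3)) (x + a) := by
  have hmp : ∀ a : UnitAddTorus (Fin 3), MeasurePreserving (fun x : UnitAddTorus (Fin 3) => x + a) volume volume :=
    fun a => measurePreserving_add_right volume a
  set S : UnitAddTorus (Fin 3) → Lp (EuclideanSpace ℝ (Fin 3)) 2 (volume : Measure (UnitAddTorus (Fin 3))) →ₗᵢ[ℝ]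
      Lp (EuclideanSpace ℝ (Fin 3)) 2 (volume : Measure (UnitAddTorus (Fin 3))) :=
    fun a => Lp.compMeasurePreservingₗᵢ ℝ (fun x : UnitAddTorus (Fin 3) => x + a) (hmp a) with hSdef
  have hS : ∀ (a : UnitAddTorus (Fin 3)) (v : Lp (EuclideanSpace ℝ (Fin 3)) 2 (volume : Measure (UnitAddTorus (Fin 3)))),
      ((S a v : Lp (EuclideanSpace ℝ (Fin 3)) 2 (volume : Measure (UnitAddTorus (Fin 3)))) :
          UnitAddTorus (Fin 3) → EuclideanSpace ℝ (Fin 3)) =ᵐ[volume]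
        fun x => (v : UnitAddTorus (Fin 3) → EuclideanSpace ℝ (Fin 3)) (x + a) :=
    fun a v => Lp.coeFn_compMeasurePreserving v (hmp a)
  -- translation preserves `H`
  have hmem : ∀ (a : UnitAddTorus (Fin 3)) (v : Lp (EuclideanSpace ℝ (Fin 3)) 2 (volume : Measure (UnitAddTorus (Fin 3)))),
      v ∈ Torus.energySpace (Fin 3) → S a v ∈ Torus.energySpace (Fin 3) := by
    intro a v hv
    have key : Torus.energySpace (Fin 3) ≤ (Torus.energySpace (Fin 3)).comap (S a).toLinearMap := by
      refine Submodule.topologicalClosure_minimal _ ?_ ?_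
      · rw [Submodule.span_le]
        rintro w ⟨g, hgs, hgd, hgm, hae⟩
        refine Torus.smoothSolenoidal_subset_energySpace ⟨fun y => g (y + a), hgs.comp_add_right a,
          isDivFree_comp_add_right hgd a, hasZeroMean_comp_add_right hgm a, ?_⟩
        exact (hS a w).trans ((hmp a).quasiMeasurePreserving.ae_eq_comp hae)
      · exact Torus.isClosed_energySpace.preimage (S a).continuous
    exact key hv
  -- translation by `-a` undoes translation by `a`
  have hinv : ∀ (a : UnitAddTorus (Fin 3)) (v : Lp (EuclideanSpace ℝ (Fin 3)) 2 (volume : Measure (UnitAddTorus (Fin 3)))),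
      S (-a) (S a v) = v := by
    intro a v
    refine Lp.ext ((hS (-a) (S a v)).trans ?_)
    refine ((hmp (-a)).quasiMeasurePreserving.ae_eq_comp (hS a v)).trans (Eventually.of_forall fun x => ?_)
    simp only [Function.comp_apply, neg_add_cancel_right]
  have hinv' : ∀ (a : UnitAddTorus (Fin 3)) (v : Lp (EuclideanSpace ℝ (Fin 3)) 2 (volume : Measure (UnitAddTorus (Fin 3)))),
      S a (S (-a) v) = v := fun a v => by simpa only [neg_neg] using hinv (-a) v
  have hcont : ∀ a : UnitAddTorus (Fin 3), Continuous fun u : Torus.energySpace (Fin 3) =>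
      (⟨S a u.1, hmem a u.1 u.2⟩ : Torus.energySpace (Fin 3)) :=
    fun a => ((S a).continuous.comp continuous_subtype_val).subtype_mk _
  exact ⟨fun a =>
    { toFun := fun u => ⟨S a u.1, hmem a u.1 u.2⟩
      invFun := fun u => ⟨S (-a) u.1, hmem (-a) u.1 u.2⟩
      left_inv := fun u => Subtype.ext (hinv a u.1)
      right_inv := fun u => Subtype.ext (hinv' a u.1)
      continuous_toFun := hcont a
      continuous_invFun := hcont (-a) }, fun a u => hS a u.1⟩

section Covariance

variable {T : UnitAddTorus (Fin 3) → Torus.energySpace (Fin 3) ≃ₜ Torus.energySpace (Fin 3)}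
  (hT : ∀ (a : UnitAddTorus (Fin 3)) (u : Torus.energySpace (Fin 3)),
    (((T a u).1 : Lp (EuclideanSpace ℝ (Fin 3)) 2 (volume : Measure (UnitAddTorus (Fin 3)))) :
        UnitAddTorus (Fin 3) → EuclideanSpace ℝ (Fin 3)) =ᵐ[volume]
      fun x => ((u.1 : Lp (EuclideanSpace ℝ (Fin 3)) 2 (volume : Measure (UnitAddTorus (Fin 3)))) :
        UnitAddTorus (Fin 3) → EuclideanSpace ℝ (Fin 3)) (x + a))

include hT

/-- **Pairings transform covariantly**: `(T a u, g) = (u, g(· - a))`. [folklore] -/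
theorem pairing_shiftOp (a : UnitAddTorus (Fin 3)) (u : Torus.energySpace (Fin 3))
    (g : UnitAddTorus (Fin 3) → EuclideanSpace ℝ (Fin 3)) :
    Torus.pairing (T a u).1 g = Torus.pairing u.1 fun x => g (x - a) := by
  unfold Torus.pairing
  rw [integral_congr_ae ((hT a u).mono fun x hx => by
    show ⟪_, g x⟫_ℝ = ⟪((u.1 : Lp (EuclideanSpace ℝ (Fin 3)) 2 (volume : Measure (UnitAddTorus (Fin 3)))) :
        UnitAddTorus (Fin 3) → EuclideanSpace ℝ (Fin 3)) (x + a), g x⟫_ℝ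
    rw [hx])]
  exact integral_inner_comp_add_right _ g a

/-- **The linear (Stokes) integrand transforms covariantly**: `(T a u, Δg) = (u, Δ(g(· - a)))`.
[folklore] -/
theorem integral_inner_laplacian_shiftOp (a : UnitAddTorus (Fin 3)) (u : Torus.energySpace (Fin 3))
    (g : UnitAddTorus (Fin 3) → EuclideanSpace ℝ (Fin 3)) :
    ∫ x, ⟪(((T a u).1 : Lp (EuclideanSpace ℝ (Fin 3)) 2 (volume : Measure (UnitAddTorus (Fin 3)))) :
        UnitAddTorus (Fin 3) → EuclideanSpace ℝ (Fin 3)) x, Torus.laplacian g x⟫_ℝ =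
      ∫ x, ⟪((u.1 : Lp (EuclideanSpace ℝ (Fin 3)) 2 (volume : Measure (UnitAddTorus (Fin 3)))) :
        UnitAddTorus (Fin 3) → EuclideanSpace ℝ (Fin 3)) x, Torus.laplacian (fun y => g (y - a)) x⟫_ℝ := by
  have h := pairing_shiftOp hT a u (Torus.laplacian g)
  unfold Torus.pairing at h
  rw [h]
  refine integral_congr_ae (Eventually.of_forall fun x => ?_)
  simp only [sub_eq_add_neg, laplacian_comp_add_right]

/-- **The inertial pairing transforms covariantly**: `∫ (T a u ⊗ T a u) : ∇g = ∫ (u ⊗ u) : ∇(g(· - a))`.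
[folklore] -/
theorem inertialPairing_shiftOp (a : UnitAddTorus (Fin 3)) (u : Torus.energySpace (Fin 3))
    (g : UnitAddTorus (Fin 3) → EuclideanSpace ℝ (Fin 3)) :
    Torus.inertialPairing (T a u).1 g = Torus.inertialPairing u.1 fun x => g (x - a) := by
  unfold Torus.inertialPairing
  rw [integral_congr_ae ((hT a u).mono fun x hx => by
    show ⟪Torus.fderiv g x _, _⟫_ℝ = ⟪Torus.fderiv g x (((u.1 : Lp (EuclideanSpace ℝ (Fin 3)) 2
        (volume : Measure (UnitAddTorus (Fin 3)))) : UnitAddTorus (Fin 3) → EuclideanSpace ℝ (Fin 3)) (x + a)),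
        ((u.1 : Lp (EuclideanSpace ℝ (Fin 3)) 2 (volume : Measure (UnitAddTorus (Fin 3)))) :
          UnitAddTorus (Fin 3) → EuclideanSpace ℝ (Fin 3)) (x + a)⟫_ℝ
    rw [hx])]
  exact integral_inner_fderiv_comp_add_right _ g a

/-- **The generator row transforms covariantly under a shear fixing the force**:
`⟨F(T a u), g⟩ = ⟨F(u), g(· - a)⟩` whenever `f(· + a) = f`. [folklore] -/
theorem nsGeneratorPairing_shiftOp (ν : ℝ) {f : UnitAddTorus (Fin 3) → EuclideanSpace ℝ (Fin 3)}
    {a : UnitAddTorus (Fin 3)} (hf : ∀ x, f (x + a) = f x) (u : Torus.energySpace (Fin 3))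
    (g : UnitAddTorus (Fin 3) → EuclideanSpace ℝ (Fin 3)) :
    Torus.nsGeneratorPairing ν f (T a u) g = Torus.nsGeneratorPairing ν f u fun x => g (x - a) := by
  unfold Torus.nsGeneratorPairing
  rw [integral_inner_comp_sub_right_of_invariant hf g, integral_inner_laplacian_shiftOp hT,
    inertialPairing_shiftOp hT]

/-- **The Fourier truncation of a translate is the translate of the truncation.** [folklore] -/
theorem fourierTruncate_shiftOp (N : ℕ) (a : UnitAddTorus (Fin 3)) (u : Torus.energySpace (Fin 3)) :
    Torus.fourierTruncate N ((((T a u).1 : Lp (EuclideanSpace ℝ (Fin 3)) 2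
        (volume : Measure (UnitAddTorus (Fin 3)))) : UnitAddTorus (Fin 3) → EuclideanSpace ℝ (Fin 3))) =
      fun x => Torus.fourierTruncate N (((u.1 : Lp (EuclideanSpace ℝ (Fin 3)) 2
        (volume : Measure (UnitAddTorus (Fin 3)))) : UnitAddTorus (Fin 3) → EuclideanSpace ℝ (Fin 3))) (x + a) := by
  rw [fourierTruncate_congr_ae (hT a u), fourierTruncate_comp_add_right]

/-- **The energy row is shear invariant**: `⟨F(T a u), P_N (T a u)⟩ = ⟨F(u), P_N u⟩`. [folklore] -/
theorem nsGeneratorPairing_fourierTruncate_shiftOp (ν : ℝ) {f : UnitAddTorus (Fin 3) → EuclideanSpace ℝ (Fin 3)}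
    {a : UnitAddTorus (Fin 3)} (hf : ∀ x, f (x + a) = f x) (N : ℕ) (u : Torus.energySpace (Fin 3)) :
    Torus.nsGeneratorPairing ν f (T a u) (Torus.fourierTruncate N ((((T a u).1 : Lp (EuclideanSpace ℝ (Fin 3)) 2
        (volume : Measure (UnitAddTorus (Fin 3)))) : UnitAddTorus (Fin 3) → EuclideanSpace ℝ (Fin 3)))) =
      Torus.nsGeneratorPairing ν f u (Torus.fourierTruncate N (((u.1 : Lp (EuclideanSpace ℝ (Fin 3)) 2
        (volume : Measure (UnitAddTorus (Fin 3)))) : UnitAddTorus (Fin 3) → EuclideanSpace ℝ (Fin 3)))) := by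
  rw [fourierTruncate_shiftOp hT, nsGeneratorPairing_shiftOp hT ν hf]
  simp only [sub_add_cancel]

/-- **The helicity row is shear invariant**: `⟨F(T a u), curl P_N (T a u)⟩ = ⟨F(u), curl P_N u⟩`.
[folklore] -/
theorem nsGeneratorPairing_curl_fourierTruncate_shiftOp (ν : ℝ) {f : UnitAddTorus (Fin 3) → EuclideanSpace ℝ (Fin 3)}
    {a : UnitAddTorus (Fin 3)} (hf : ∀ x, f (x + a) = f x) (N : ℕ) (u : Torus.energySpace (Fin 3)) :
    Torus.nsGeneratorPairing ν f (T a u) (BDSV.curl (Torus.fourierTruncate N ((((T a u).1 :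
        Lp (EuclideanSpace ℝ (Fin 3)) 2 (volume : Measure (UnitAddTorus (Fin 3)))) :
          UnitAddTorus (Fin 3) → EuclideanSpace ℝ (Fin 3))))) =
      Torus.nsGeneratorPairing ν f u (BDSV.curl (Torus.fourierTruncate N (((u.1 :
        Lp (EuclideanSpace ℝ (Fin 3)) 2 (volume : Measure (UnitAddTorus (Fin 3)))) :
          UnitAddTorus (Fin 3) → EuclideanSpace ℝ (Fin 3))))) := by
  rw [fourierTruncate_shiftOp hT, curl_comp_add_right', nsGeneratorPairing_shiftOp hT ν hf]
  simp only [sub_add_cancel]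

/-- **Translation is isometric on `H`.** [folklore] -/
theorem norm_shiftOp (a : UnitAddTorus (Fin 3)) (u : Torus.energySpace (Fin 3)) : ‖T a u‖ = ‖u‖ := by
  have e1 : ‖T a u‖ = ‖((T a u).1 : Lp (EuclideanSpace ℝ (Fin 3)) 2 (volume : Measure (UnitAddTorus (Fin 3))))‖ := rfl
  have e2 : ‖u‖ = ‖(u.1 : Lp (EuclideanSpace ℝ (Fin 3)) 2 (volume : Measure (UnitAddTorus (Fin 3))))‖ := rfl
  have h1 : ‖T a u‖ ^ 2 = ‖u‖ ^ 2 := by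
    rw [e1, e2, ← Torus.integral_norm_sq_coe_eq, ← Torus.integral_norm_sq_coe_eq,
      integral_congr_ae ((hT a u).mono fun x hx => by
        show ‖_‖ ^ 2 = ‖((u.1 : Lp (EuclideanSpace ℝ (Fin 3)) 2 (volume : Measure (UnitAddTorus (Fin 3)))) :
            UnitAddTorus (Fin 3) → EuclideanSpace ℝ (Fin 3)) (x + a)‖ ^ 2
        rw [hx])]
    exact integral_add_right_eq_self (μ := (volume : Measure (UnitAddTorus (Fin 3))))
      (fun x => ‖((u.1 : Lp (EuclideanSpace ℝ (Fin 3)) 2 (volume : Measure (UnitAddTorus (Fin 3)))) :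
        UnitAddTorus (Fin 3) → EuclideanSpace ℝ (Fin 3)) x‖ ^ 2) a
  exact (pow_left_inj₀ (norm_nonneg _) (norm_nonneg _) two_ne_zero).1 h1

/-- **Translation preserves the enstrophy.** [folklore] -/
theorem eGradNormSq_shiftOp (a : UnitAddTorus (Fin 3)) (u : Torus.energySpace (Fin 3)) :
    Torus.eGradNormSq ((((T a u).1 : Lp (EuclideanSpace ℝ (Fin 3)) 2
        (volume : Measure (UnitAddTorus (Fin 3)))) : UnitAddTorus (Fin 3) → EuclideanSpace ℝ (Fin 3))) =
      Torus.eGradNormSq (((u.1 : Lp (EuclideanSpace ℝ (Fin 3)) 2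
        (volume : Measure (UnitAddTorus (Fin 3)))) : UnitAddTorus (Fin 3) → EuclideanSpace ℝ (Fin 3))) := by
  rw [eGradNormSq_congr_ae (hT a u), eGradNormSq_comp_add_right]

/-- **Translation preserves the level property.** [folklore] -/
theorem isLevel_shiftOp_iff (N : ℕ) (a : UnitAddTorus (Fin 3)) (u : Torus.energySpace (Fin 3)) :
    IsLevel N (T a u) ↔ IsLevel N u := by
  unfold IsLevel
  refine forall₂_congr fun k _ => ?_
  rw [Torus.mFourierCoeff_congr_ae ((hT a u).fun_comp EuclideanSpace.complexify) k]
  exact mFourierCoeff_comp_add_right_eq_zero_iff _ a k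

end Covariance

end

/-- **Registered sub-goal `designSymShiftOp_exists` of stub S6′** (summary of this file): shear
translations act on the energy space by homeomorphisms represented a.e. by `u ↦ u(· + a)`.
[folklore] -/
theorem designSymShiftOp_exists : ∃ T : UnitAddTorus (Fin 3) → Torus.energySpace (Fin 3) ≃ₜ Torus.energySpace (Fin 3), ∀ (a : UnitAddTorus (Fin 3)) (u : Torus.energySpace (Fin 3)), ((T a u).1 : UnitAddTorus (Fin 3) → EuclideanSpace ℝ (Fin 3)) =ᵐ[volume] fun x => (u.1 : UnitAddTorus (Fin 3) → EuclideanSpace ℝ (Fin 3)) (x + a) :=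
  exists_shiftOp

end Summit.AnomalousDissipation.AnomalousDissipation.Theorems.MomentParityQuarticGate
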